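import Mathlib
import HarnessLib
import Summits.NavierStokesRegularity.NavierStokesRegularity.Theorems.UnthreadedDoorNetFluxDefs
import Summits.NavierStokesRegularity.NavierStokesRegularity.Theorems.UnthreadedDoorNetFluxStratumReduction
import Summits.NavierStokesRegularity.NavierStokesRegularity.Theorems.UnthreadedDoorNetFluxWindowDecayViscosity
import Summits.NavierStokesRegularity.NavierStokesRegularity.Theorems.UnthreadedDoorNetFluxOneSidedLaw
import Summits.NavierStokesRegularity.NavierStokesRegularity.Theorems.UnthreadedDoorNetFluxEnvelopeFacts
import Summits.NavierStokesRegularity.NavierStokesRegularity.Theorems.UnthreadedDoorNetFluxNearCentreFlux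
import Summits.NavierStokesRegularity.NavierStokesRegularity.Theorems.UnthreadedDoorNetFluxOscLeVorticity
import Summits.NavierStokesRegularity.NavierStokesRegularity.Theorems.UnthreadedDoorNetFluxExtremalHeadEMF

/-!
# Route `UnthreadedDoor`, crux `PoloidalLiouville` (stmt-NavierStokesRegularity-1222), WALL W1 — netflux line:
# **THE STRATUM RUNG `NetFlux.UnimodalScalarLiouvilleTypeI` IS A KERNEL THEOREM**

The registered line `Cruxes/PoloidalLiouville/Lines/netflux_typei_gap.lean` (planner ns-idea-14, v9 25065be6030e) composes its
target, the STRATUM statement `UnimodalScalarLiouvilleTypeI` («saddle-free Type-I scalar Liouville»: a bounded ancient mild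
solution with Type-I decay whose vorticity is `∇T × (x − x₀)` for a bounded `T` smooth off the centre, obeying the curled law (E1),
with every sphere `S_r(x₀)` saddle-free for every `T(t)`, has `∇T ∥ (x − x₀)`, i.e. `ω ≡ 0`), from the stubs NF-0 … NF-6.  Every
stub is now a Theorems-side theorem, so the composition can be stated here, BY NAME, against the Theorems twin of the target
(`UnthreadedDoorNetFluxDefs`, p660450, verbatim body):

`unimodalScalarLiouvilleTypeI_holds : UnimodalScalarLiouvilleTypeI :=`
`  unimodalScalarLiouvilleTypeI_of_netFluxWindowDecay` (S⁺ ⇒ target, p660934, ARM A g3)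
`    (netFluxWindowDecay_of_laws` (NF-4ᵛ, p669139, ARM A g3)
`      (oneSidedNetFluxLaw_of_hinges` (NF-1cᵛ, p673578, ns-qj-p1 g5) `envelopeFacts` (NF-1bᵛ, p667268, ns-qj-p1 g4)
`        extremalHeadEMF)` (NF-1a, p675379, ARM A g4)
`      oscLeVorticity` (NF-0, p660776) `nearCentreFlux)` (NF-6, p668552, ns-qj-p1 g4).

HONEST FRAME (LADDER bookkeeping): this is the RUNG of one crux idea — a decided SUB-CLASS of W1.  It does NOT prove
`PoloidalLiouville` (stmt 1222), the wall stub `stub_scalarLiouville`, the typed residual `MultiHillScalarLiouvilleTypeI`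
(multi-hill spheres), or Navier–Stokes regularity; W1 movement stays 0.  `--supports stmt-NavierStokesRegularity-1222 --as helper`.
[cite: KochNadirashviliSereginSverak2009, Thm 5.2 (arXiv:0709.3599)]
-/

noncomputable section

-- the summit and its single sub-problem share the name (CONVENTIONS §1)
set_option linter.dupNamespace false

namespace Summit.NavierStokesRegularity.NavierStokesRegularity.Theorems.PoloidalLiouville.NetFlux

/-- **The saddle-free Type-I scalar Liouville theorem (stratum rung of the netflux line on crux 1222) — PROVED, unconditionally,
standard axioms.**  Composition of the line's landed stubs, see the module docstring.  Not `PoloidalLiouville`, not NS regularity.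
[folklore] -/
theorem unimodalScalarLiouvilleTypeI_holds : UnimodalScalarLiouvilleTypeI :=
  unimodalScalarLiouvilleTypeI_of_netFluxWindowDecay
    (netFluxWindowDecay_of_laws (oneSidedNetFluxLaw_of_hinges envelopeFacts extremalHeadEMF) oscLeVorticity nearCentreFlux)

end Summit.NavierStokesRegularity.NavierStokesRegularity.Theorems.PoloidalLiouville.NetFlux

end
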